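import Summits.Ventures.Crystal3D.Theorems.StickyWulffConstantNoReconstructionGainPredSlotBudgetRaisedThreeRegions
import HarnessLib

/-!
# Raised up bond, three contacts: classification of one contact (regime II)

HONEST FRAMING. Part of the venture `Summits/Ventures/Crystal3D` (cell `crystal3d-full`), helper
`--supports` the crux `NoReconstructionGain` (stmt-Ventures-19144, route
`route-Ventures-StickyWulffConstant`), line `adhesion` (wulff-p1 g15).  Frame `n = (a,b,c)` in region
R ∩ regime II, contact `U = (x,y,z)` of depth `> T₀ = b + c` avoiding the caps of `W₁, W₂, B₁`
(`U·W₁ ≤ 1`, `U·W₂ ≤ 1`, `U·B₁ ≤ 1`).  With `ar(X,Y) = det[X,Y,n]` (sign of the azimuth from `X` to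
`Y`), the azimuth circle is covered by: the west wedge (`westWedge_false`), the wedge `W₁ → B₁` (split
by the meridian of `P̃_N` into `regionW1_false` and `zoneW1_false`), the wedge `B₁ → B₂`
(`regionN_false`), the survivor wedge `B₂ → Z`, and the wedge `Z → W₂` (excluded by the caller's
hypothesis `hS`, an instance of `regionS_false`).  Coverage is the Plücker relation for the triple
`(W₂, B₁, Z)`.  Result (`survivor_core`): the contact is a survivor, `ar(B₂,U) ≤ 0 ≤ ar(Z,U)`.
`survivorB` / `survivorA` instantiate `Z = B̃_S` (case B: `ar(B̃_S,P̃*) ≥ 0`) and `Z = Z̃_S = R_Y(W₁)`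
(case A: `ar(B̃_S,P̃*) ≤ 0`).

WHAT THIS IS NOT: the pair step and the count; rung F-C1 not moved.
-/

namespace Summit.Ventures.Crystal3D.Theorems

/-- **Plücker relation** for the alternating form `ar(X,Y) = det[X,Y,n]` of the tangent plane:
`ar(X,Y)ar(Z,W) − ar(X,Z)ar(Y,W) + ar(X,W)ar(Y,Z) = 0`. -/
theorem ar_plucker (a b c x₁ x₂ x₃ y₁ y₂ y₃ z₁ z₂ z₃ w₁ w₂ w₃ : ℝ) :
    ((x₁) * ((y₂) * c - (y₃) * b) - (x₂) * ((y₁) * c - (y₃) * a) + (x₃) * ((y₁) * b - (y₂) * a)) * ((z₁) * ((w₂) * c - (w₃) * b) - (z₂) * ((w₁) * c - (w₃) * a) + (z₃) * ((w₁) * b - (w₂) * a)) -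
    ((x₁) * ((z₂) * c - (z₃) * b) - (x₂) * ((z₁) * c - (z₃) * a) + (x₃) * ((z₁) * b - (z₂) * a)) * ((y₁) * ((w₂) * c - (w₃) * b) - (y₂) * ((w₁) * c - (w₃) * a) + (y₃) * ((w₁) * b - (w₂) * a)) +
    ((x₁) * ((w₂) * c - (w₃) * b) - (x₂) * ((w₁) * c - (w₃) * a) + (x₃) * ((w₁) * b - (w₂) * a)) * ((y₁) * ((z₂) * c - (z₃) * b) - (y₂) * ((z₁) * c - (z₃) * a) + (y₃) * ((z₁) * b - (z₂) * a)) = 0 := by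
  ring

/-- **Survivor (generic south end `Z = (e₁,e₂,e₃)`).**  If `Z` is strictly before `W₂` and strictly
after `B₁` (`kWZ`, `kBZ`) and contacts strictly between `Z` and `W₂` are excluded (`hS`), then a
contact avoiding the three caps has its tangent direction in the survivor wedge: `ar(B₂,U) ≤ 0` and
`ar(Z,U) ≥ 0`. -/
theorem survivor_core {a b c x y z e₁ e₂ e₃ : ℝ} (hn : a ^ 2 + b ^ 2 + c ^ 2 = 2) (hu : x ^ 2 + y ^ 2 + z ^ 2 = 2)
    (hg1 : 0 ≤ -b + a) (hg2 : 0 ≤ b + a) (hg3 : 0 ≤ -209 + 256 * c + 256 * b - 256 * a)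
    (hg4 : 0 ≤ 2 - c ^ 2 - 2 * b * c - b ^ 2) (hg5 : 0 ≤ 5 - 8 * a) (hg6 : 0 ≤ -9 + 8 * c) (hg7 : 0 ≤ 5 - 16 * b)
    (hII : (b + c) ^ 2 < 2) (hdT : b + c < a * x + b * y + c * z)
    (hUW1 : y + z ≤ 1) (hUW2 : -x + z ≤ 1) (hUB1 : x + y ≤ 1)
    (kWZ : 0 < (((-1)) * ((e₂) * c - (e₃) * b) - (0) * ((e₁) * c - (e₃) * a) + (1) * ((e₁) * b - (e₂) * a))) (kBZ : ((1) * ((e₂) * c - (e₃) * b) - (1) * ((e₁) * c - (e₃) * a) + (0) * ((e₁) * b - (e₂) * a)) < 0)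
    (hS : ((e₁) * ((y) * c - (z) * b) - (e₂) * ((x) * c - (z) * a) + (e₃) * ((x) * b - (y) * a)) < 0 → 0 < (((-1)) * ((y) * c - (z) * b) - (0) * ((x) * c - (z) * a) + (1) * ((x) * b - (y) * a)) → False) :
    ((1) * ((y) * c - (z) * b) - (0) * ((x) * c - (z) * a) + (1) * ((x) * b - (y) * a)) ≤ 0 ∧ 0 ≤ ((e₁) * ((y) * c - (z) * b) - (e₂) * ((x) * c - (z) * a) + (e₃) * ((x) * b - (y) * a)) := by
  have hT0 : 1 < b + c := by have := cert_T0m1 hn hg1 hg2 hg3 hg4; linarith only [this]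
  -- D1: the west wedge `ar(W₂,U) ≤ 0 ≤ ar(W₁,U)`
  by_cases D1 : (((-1)) * ((y) * c - (z) * b) - (0) * ((x) * c - (z) * a) + (1) * ((x) * b - (y) * a)) ≤ 0 ∧ 0 ≤ ((0) * ((y) * c - (z) * b) - (1) * ((x) * c - (z) * a) + (1) * ((x) * b - (y) * a))
  · exfalso
    have hf1 : 0 < 8 - 4 * (b + c) ^ 2 - 3 * (c - a) ^ 2 + 4 * (c - a) * (b + c) := by
      have := fact_hf1 hn hg1 hg2 hg4 hg5 hg6 hg7; nlinarith only [this, hn]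
    have hf2 : 0 < -3 * (2 - (b + c) ^ 2) ^ 2 + (c - a) * (b + c) * (4 + 2 * (b + c) ^ 2 - 3 * ((c - a) * (b + c))) := by
      have e : -3 * (2 - (b + c) ^ 2) ^ 2 + (c - a) * (b + c) * (4 + 2 * (b + c) ^ 2 - 3 * ((c - a) * (b + c))) =
          (4 + 4 * b * c - 18 * b ^ 2 + 2 * b ^ 3 * c + 8 * b ^ 4 + 4 * a * c + 8 * a * b - 4 * a * b ^ 2 * c - 8 * a * b ^ 3 - 6 * a ^ 2 + 6 * a ^ 2 * b * c + 7 * a ^ 2 * b ^ 2 - 4 * a ^ 3 * c - 6 * a ^ 3 * b - a ^ 4) + (8 - 4 * c ^ 2 - 12 * b * c - 11 * b ^ 2 + 4 * a * c + 6 * a * b + a ^ 2) * (a ^ 2 + b ^ 2 + c ^ 2 - 2) := by ring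
      have hh : a ^ 2 + b ^ 2 + c ^ 2 - 2 = 0 := by linarith only [hn]
      rw [e, hh, mul_zero, add_zero]; have := cert_hf2 hn hg1 hg2 hg3 hg4; linarith only [this]
    have e1 : x * (c - b) + a * y - a * z = -((0) * ((y) * c - (z) * b) - (1) * ((x) * c - (z) * a) + (1) * ((x) * b - (y) * a)) := by ring
    have e2 : b * (x + z) - c * y - a * y = (((-1)) * ((y) * c - (z) * b) - (0) * ((x) * c - (z) * a) + (1) * ((x) * b - (y) * a)) := by ring
    exact westWedge_false (T := a * x + b * y + c * z) hn hu le_rfl hdT hT0 hII.le (by linarith only [hg5, hg6])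
      (by linarith only [hg2]) (by linarith only [hg1, hg2, hg5, hg6]) hf1 hf2 hUW1 (by linarith only [hUW2])
      (by linarith only [D1.2, e1]) (by linarith only [D1.1, e2])
  -- D2: the wedge `W₁ → B₁`
  by_cases D2 : ((0) * ((y) * c - (z) * b) - (1) * ((x) * c - (z) * a) + (1) * ((x) * b - (y) * a)) < 0 ∧ 0 ≤ ((1) * ((y) * c - (z) * b) - (1) * ((x) * c - (z) * a) + (0) * ((x) * b - (y) * a))
  · exfalso
    by_cases hP : 0 < ((x) * ((4) * c - ((-1)) * b) - (y) * (((-1)) * c - ((-1)) * a) + (z) * (((-1)) * b - (4) * a))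
    · -- template with reference `W₁`
      have e1 : (x * (1 * c - 0 * b) - y * (1 * c - 0 * a) + z * (1 * b - 1 * a)) * ((0) * (1 * c - 0 * b) - (1) * (1 * c - 0 * a) + (1) * (1 * b - 1 * a)) = ((1) * ((y) * c - (z) * b) - (1) * ((x) * c - (z) * a) + (0) * ((x) * b - (y) * a)) * (a + c - b) := by ring
      have e2 : ((0) * (y * c - z * b) - (1) * (x * c - z * a) + (1) * (x * b - y * a)) * ((0) * (1 * c - 0 * b) - (1) * (1 * c - 0 * a) + (1) * (1 * b - 1 * a)) = (-((0) * ((y) * c - (z) * b) - (1) * ((x) * c - (z) * a) + (1) * ((x) * b - (y) * a))) * (a + c - b) := by ring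
      have pl := ar_plucker a b c 0 1 1 1 1 0 x y z 1 0 1
      -- `ar(W₁,B₁) ar(U,B₂) = ar(W₁,U) ar(B₁,B₂) + ar(W₁,B₂) ar(B₁,U)`… sign of `ar(U,B₂)`
      have hB2 : ((x) * ((0) * c - (1) * b) - (y) * ((1) * c - (1) * a) + (z) * ((1) * b - (0) * a)) < 0 := by
        have h7 := fact_f7 hg5 hg6 hg7
        have hbca : (0:ℝ) < b + c - a := by linarith only [hT0, hg5]
        have hR : 0 < ((0) * ((1) * c - (0) * b) - (1) * ((1) * c - (0) * a) + (1) * ((1) * b - (1) * a)) * ((x) * ((0) * c - (1) * b) - (y) * ((1) * c - (1) * a) + (z) * ((1) * b - (0) * a)) := by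
          nlinarith only [pl, mul_pos (neg_pos.2 D2.1) hbca, mul_nonneg D2.2 h7.le]
        by_contra h
        push Not at h
        nlinarith only [hR, mul_nonneg h (by linarith only [hg1, hg2, hg5, hg6] : (0:ℝ) ≤ a + c - b)]
      have e3 : (1 * (b * z - c * y) + 0 * (c * x - a * z) + 1 * (a * y - b * x)) * ((-1 / 3) * (b * z - c * y) + (4 / 3) * (c * x - a * z) + (-1 / 3) * (a * y - b * x)) = (1 / 3) * (((x) * ((0) * c - (1) * b) - (y) * ((1) * c - (1) * a) + (z) * ((1) * b - (0) * a)) * ((x) * ((4) * c - ((-1)) * b) - (y) * (((-1)) * c - ((-1)) * a) + (z) * (((-1)) * b - (4) * a))) := by ring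
      refine regionW1_false hn hu hg1 hg2 hg3 hg4 hg5 hg6 hg7 hdT hUB1 hUW1 ?_ ?_ ?_
      · rw [e1]; exact mul_nonneg D2.2 (by linarith only [hg1, hg2, hg5, hg6])
      · rw [e2]; exact mul_pos (neg_pos.2 D2.1) (by linarith only [hg1, hg2, hg5, hg6])
      · rw [e3]; nlinarith only [mul_neg_of_neg_of_pos hB2 hP]
    · -- pole-cap zone: `ar(U,P̃_N) ≤ 0`
      push Not at hP
      have pl := ar_plucker a b c 0 1 1 x y z (-1) 4 (-1) 1 1 0
      -- `ar(W₁,U) ar(P̃_N,B₁) − ar(W₁,P̃_N) ar(U,B₁) + ar(W₁,B₁) ar(U,P̃_N) = 0`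
      have e1 : ((0) * ((y) * c - (z) * b) - (1) * ((x) * c - (z) * a) + (1) * ((x) * b - (y) * a)) = ((0) * ((y) * c - (z) * b) - (1) * ((x) * c - (z) * a) + (1) * ((x) * b - (y) * a)) := rfl
      have hprod : 0 < ((0) * ((4) * c - ((-1)) * b) - (1) * (((-1)) * c - ((-1)) * a) + (1) * (((-1)) * b - (4) * a)) * ((x) * ((1) * c - (0) * b) - (y) * ((1) * c - (0) * a) + (z) * ((1) * b - (1) * a)) := by
        nlinarith only [pl, D2.1, D2.2, hP, hg5, hg6, hg7, hg1, hg2,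
          mul_pos (neg_pos.2 D2.1) (by linarith only [hg1, hg2, hg5, hg6] : (0:ℝ) < -(a - b - 5 * c)),
          mul_nonneg (by linarith only [hg1, hg2, hg5, hg6] : (0:ℝ) ≤ -(b - a - c)) (neg_nonneg.2 hP)]
      have eB : ((x) * ((1) * c - (0) * b) - (y) * ((1) * c - (0) * a) + (z) * ((1) * b - (1) * a)) = -((1) * ((y) * c - (z) * b) - (1) * ((x) * c - (z) * a) + (0) * ((x) * b - (y) * a)) := by ring
      rw [eB] at hprod
      have hB1n : ((1) * ((y) * c - (z) * b) - (1) * ((x) * c - (z) * a) + (0) * ((x) * b - (y) * a)) ≠ 0 := by intro h; rw [h] at hprod; simp at hprod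
      have hB1p : 0 < ((1) * ((y) * c - (z) * b) - (1) * ((x) * c - (z) * a) + (0) * ((x) * b - (y) * a)) := lt_of_le_of_ne D2.2 (Ne.symm hB1n)
      have hWP : ((0) * ((4) * c - ((-1)) * b) - (1) * (((-1)) * c - ((-1)) * a) + (1) * (((-1)) * b - (4) * a)) < 0 := by
        by_contra h; push Not at h; nlinarith only [hprod, h, hB1p, mul_nonneg h hB1p.le]
      have eD : (((-1)) * (1 * c - 1 * b) - (4) * (0 * c - 1 * a) + ((-1)) * (0 * b - 1 * a)) = -((0) * ((4) * c - ((-1)) * b) - (1) * (((-1)) * c - ((-1)) * a) + (1) * (((-1)) * b - (4) * a)) := by ring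
      refine zoneW1_false hn hu hg1 hg2 hg3 hg4 hg5 hg6 hII hdT hUW1 ?_ ?_ ?_
      · rw [eD]; exact neg_ne_zero.2 (ne_of_lt hWP)
      · have e : (x * (1 * c - 1 * b) - y * (0 * c - 1 * a) + z * (0 * b - 1 * a)) * (((-1)) * (1 * c - 1 * b) - (4) * (0 * c - 1 * a) + ((-1)) * (0 * b - 1 * a)) = ((0) * ((y) * c - (z) * b) - (1) * ((x) * c - (z) * a) + (1) * ((x) * b - (y) * a)) * ((0) * ((4) * c - ((-1)) * b) - (1) * (((-1)) * c - ((-1)) * a) + (1) * (((-1)) * b - (4) * a)) := by ring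
        rw [e]; exact (mul_pos_of_neg_of_neg D2.1 hWP).le
      · have e : (((-1)) * (y * c - z * b) - (4) * (x * c - z * a) + ((-1)) * (x * b - y * a)) * (((-1)) * (1 * c - 1 * b) - (4) * (0 * c - 1 * a) + ((-1)) * (0 * b - 1 * a)) = ((x) * ((4) * c - ((-1)) * b) - (y) * (((-1)) * c - ((-1)) * a) + (z) * (((-1)) * b - (4) * a)) * ((0) * ((4) * c - ((-1)) * b) - (1) * (((-1)) * c - ((-1)) * a) + (1) * (((-1)) * b - (4) * a)) := by ring
        rw [e]; exact mul_nonneg_of_nonpos_of_nonpos hP hWP.le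
  -- D3: the wedge `B₁ → B₂`
  by_cases D3 : ((1) * ((y) * c - (z) * b) - (1) * ((x) * c - (z) * a) + (0) * ((x) * b - (y) * a)) < 0 ∧ 0 < ((1) * ((y) * c - (z) * b) - (0) * ((x) * c - (z) * a) + (1) * ((x) * b - (y) * a))
  · exfalso
    have hsN : (0:ℝ) < 4 - b ^ 2 - 2 * a * b - a ^ 2 := by nlinarith only [hg2, hg5, hg7]
    have h9 : (1:ℝ) ≤ ((2 * c ^ 2 - 2 * b * c + 2 * a * c) * (1 * c - 0 * b) - (4 - 2 * c ^ 2 + 2 * b * c - b ^ 2 - 2 * a * c - 2 * a * b - a ^ 2) * (1 * c - 0 * a) + (4 + 2 * b * c - 3 * b ^ 2 - 2 * a * c + 2 * a * b - 3 * a ^ 2) * (1 * b - 1 * a)) := by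
      have e : ((2 * c ^ 2 - 2 * b * c + 2 * a * c) * (1 * c - 0 * b) - (4 - 2 * c ^ 2 + 2 * b * c - b ^ 2 - 2 * a * c - 2 * a * b - a ^ 2) * (1 * c - 0 * a) + (4 + 2 * b * c - 3 * b ^ 2 - 2 * a * c + 2 * a * b - 3 * a ^ 2) * (1 * b - 1 * a)) = (4 * c - 4 * b - b ^ 2 * c + b ^ 3 + 4 * a - 2 * a * b * c + a * b ^ 2 - a ^ 2 * c - a ^ 2 * b - a ^ 3) + (4 * c - 4 * b + 4 * a) * (a ^ 2 + b ^ 2 + c ^ 2 - 2) := by ring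
      have hh : a ^ 2 + b ^ 2 + c ^ 2 - 2 = 0 := by linarith only [hn]
      rw [e, hh, mul_zero, add_zero]; exact cert_f9 hn hg1 hg2 hg3 hg4
    have h10 : (4:ℝ) ≤ ((2 * c ^ 2 - 2 * b * c + 2 * a * c) * ((4) * c - ((-1)) * b) - (4 - 2 * c ^ 2 + 2 * b * c - b ^ 2 - 2 * a * c - 2 * a * b - a ^ 2) * (((-1)) * c - ((-1)) * a) + (4 + 2 * b * c - 3 * b ^ 2 - 2 * a * c + 2 * a * b - 3 * a ^ 2) * (((-1)) * b - (4) * a)) := by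
      have e : ((2 * c ^ 2 - 2 * b * c + 2 * a * c) * ((4) * c - ((-1)) * b) - (4 - 2 * c ^ 2 + 2 * b * c - b ^ 2 - 2 * a * c - 2 * a * b - a ^ 2) * (((-1)) * c - ((-1)) * a) + (4 + 2 * b * c - 3 * b ^ 2 - 2 * a * c + 2 * a * b - 3 * a ^ 2) * (((-1)) * b - (4) * a)) = (16 * c - 12 * b - 11 * b ^ 2 * c + 7 * b ^ 3 - 4 * a - 8 * a * b * c + 3 * a * b ^ 2 + 3 * a ^ 2 * c + a ^ 2 * b + 5 * a ^ 3) + (6 * c - 4 * b + 8 * a) * (a ^ 2 + b ^ 2 + c ^ 2 - 2) := by ring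
      have hh : a ^ 2 + b ^ 2 + c ^ 2 - 2 = 0 := by linarith only [hn]
      rw [e, hh, mul_zero, add_zero]; exact cert_f10 hn hg1 hg2 hg3 hg4
    have h11 : ((1) * ((4 - 2 * c ^ 2 + 2 * b * c - b ^ 2 - 2 * a * c - 2 * a * b - a ^ 2) * c - (4 + 2 * b * c - 3 * b ^ 2 - 2 * a * c + 2 * a * b - 3 * a ^ 2) * b) - (0) * ((2 * c ^ 2 - 2 * b * c + 2 * a * c) * c - (4 + 2 * b * c - 3 * b ^ 2 - 2 * a * c + 2 * a * b - 3 * a ^ 2) * a) + (1) * ((2 * c ^ 2 - 2 * b * c + 2 * a * c) * b - (4 - 2 * c ^ 2 + 2 * b * c - b ^ 2 - 2 * a * c - 2 * a * b - a ^ 2) * a)) ≤ 0 := by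
      have e : ((1) * ((4 - 2 * c ^ 2 + 2 * b * c - b ^ 2 - 2 * a * c - 2 * a * b - a ^ 2) * c - (4 + 2 * b * c - 3 * b ^ 2 - 2 * a * c + 2 * a * b - 3 * a ^ 2) * b) - (0) * ((2 * c ^ 2 - 2 * b * c + 2 * a * c) * c - (4 + 2 * b * c - 3 * b ^ 2 - 2 * a * c + 2 * a * b - 3 * a ^ 2) * a) + (1) * ((2 * c ^ 2 - 2 * b * c + 2 * a * c) * b - (4 - 2 * c ^ 2 + 2 * b * c - b ^ 2 - 2 * a * c - 2 * a * b - a ^ 2) * a)) = -((a - b) * (4 - 3 * b * c - b ^ 2 - 3 * a * c - 2 * a * b - a ^ 2)) + (-2 * c + 4 * b) * (a ^ 2 + b ^ 2 + c ^ 2 - 2) := by ring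
      have hh : a ^ 2 + b ^ 2 + c ^ 2 - 2 = 0 := by linarith only [hn]
      rw [hh, mul_zero, add_zero] at e
      rw [e]; have := fact_F11b hn hg1 hg2 hg3 hg4 hg5 hg6 hg7
      nlinarith only [this, hg1, mul_nonneg hg1 this.le]
    -- `ar(B̃_N,U) > 0` from the Plücker relation for `(B₁, B₂, U, B̃_N)`
    have pl := ar_plucker a b c 1 1 0 1 0 1 x y z (2 * c ^ 2 - 2 * b * c + 2 * a * c) (4 - 2 * c ^ 2 + 2 * b * c - b ^ 2 - 2 * a * c - 2 * a * b - a ^ 2) (4 + 2 * b * c - 3 * b ^ 2 - 2 * a * c + 2 * a * b - 3 * a ^ 2)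
    have hDk : (0:ℝ) < ((2 * c ^ 2 - 2 * b * c + 2 * a * c) * (1 * c - 0 * b) - (4 - 2 * c ^ 2 + 2 * b * c - b ^ 2 - 2 * a * c - 2 * a * b - a ^ 2) * (1 * c - 0 * a) + (4 + 2 * b * c - 3 * b ^ 2 - 2 * a * c + 2 * a * b - 3 * a ^ 2) * (1 * b - 1 * a)) := by linarith only [h9]
    have hBNU : 0 < ((2 * c ^ 2 - 2 * b * c + 2 * a * c) * (y * c - z * b) - (4 - 2 * c ^ 2 + 2 * b * c - b ^ 2 - 2 * a * c - 2 * a * b - a ^ 2) * (x * c - z * a) + (4 + 2 * b * c - 3 * b ^ 2 - 2 * a * c + 2 * a * b - 3 * a ^ 2) * (x * b - y * a)) := by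
      have e : ((2 * c ^ 2 - 2 * b * c + 2 * a * c) * (y * c - z * b) - (4 - 2 * c ^ 2 + 2 * b * c - b ^ 2 - 2 * a * c - 2 * a * b - a ^ 2) * (x * c - z * a) + (4 + 2 * b * c - 3 * b ^ 2 - 2 * a * c + 2 * a * b - 3 * a ^ 2) * (x * b - y * a)) = -((x) * ((4 - 2 * c ^ 2 + 2 * b * c - b ^ 2 - 2 * a * c - 2 * a * b - a ^ 2) * c - (4 + 2 * b * c - 3 * b ^ 2 - 2 * a * c + 2 * a * b - 3 * a ^ 2) * b) - (y) * ((2 * c ^ 2 - 2 * b * c + 2 * a * c) * c - (4 + 2 * b * c - 3 * b ^ 2 - 2 * a * c + 2 * a * b - 3 * a ^ 2) * a) + (z) * ((2 * c ^ 2 - 2 * b * c + 2 * a * c) * b - (4 - 2 * c ^ 2 + 2 * b * c - b ^ 2 - 2 * a * c - 2 * a * b - a ^ 2) * a)) := by ring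
      have hR : 0 < ((1) * ((0) * c - (1) * b) - (1) * ((1) * c - (1) * a) + (0) * ((1) * b - (0) * a)) * ((x) * ((4 - 2 * c ^ 2 + 2 * b * c - b ^ 2 - 2 * a * c - 2 * a * b - a ^ 2) * c - (4 + 2 * b * c - 3 * b ^ 2 - 2 * a * c + 2 * a * b - 3 * a ^ 2) * b) - (y) * ((2 * c ^ 2 - 2 * b * c + 2 * a * c) * c - (4 + 2 * b * c - 3 * b ^ 2 - 2 * a * c + 2 * a * b - 3 * a ^ 2) * a) + (z) * ((2 * c ^ 2 - 2 * b * c + 2 * a * c) * b - (4 - 2 * c ^ 2 + 2 * b * c - b ^ 2 - 2 * a * c - 2 * a * b - a ^ 2) * a)) := by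
        nlinarith only [pl, mul_nonneg_of_nonpos_of_nonpos D3.1.le h11, mul_pos hDk D3.2]
      rw [e]
      by_contra h
      push Not at h
      have hX : 0 ≤ ((x) * ((4 - 2 * c ^ 2 + 2 * b * c - b ^ 2 - 2 * a * c - 2 * a * b - a ^ 2) * c - (4 + 2 * b * c - 3 * b ^ 2 - 2 * a * c + 2 * a * b - 3 * a ^ 2) * b) - (y) * ((2 * c ^ 2 - 2 * b * c + 2 * a * c) * c - (4 + 2 * b * c - 3 * b ^ 2 - 2 * a * c + 2 * a * b - 3 * a ^ 2) * a) + (z) * ((2 * c ^ 2 - 2 * b * c + 2 * a * c) * b - (4 - 2 * c ^ 2 + 2 * b * c - b ^ 2 - 2 * a * c - 2 * a * b - a ^ 2) * a)) := by linarith only [h]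
      nlinarith only [hR, mul_nonneg hX (by linarith only [hT0, hg5] : (0:ℝ) ≤ b + c - a)]
    -- `ar(U,P̃_N) > 0` from the Plücker relation for `(B̃_N, B₁, U, P̃_N)`
    have pl2 := ar_plucker a b c (2 * c ^ 2 - 2 * b * c + 2 * a * c) (4 - 2 * c ^ 2 + 2 * b * c - b ^ 2 - 2 * a * c - 2 * a * b - a ^ 2) (4 + 2 * b * c - 3 * b ^ 2 - 2 * a * c + 2 * a * b - 3 * a ^ 2) 1 1 0 x y z (-1) 4 (-1)
    have hUPN : 0 < ((x) * ((4) * c - ((-1)) * b) - (y) * (((-1)) * c - ((-1)) * a) + (z) * (((-1)) * b - (4) * a)) := by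
      have hR : 0 < ((2 * c ^ 2 - 2 * b * c + 2 * a * c) * ((1) * c - (0) * b) - (4 - 2 * c ^ 2 + 2 * b * c - b ^ 2 - 2 * a * c - 2 * a * b - a ^ 2) * ((1) * c - (0) * a) + (4 + 2 * b * c - 3 * b ^ 2 - 2 * a * c + 2 * a * b - 3 * a ^ 2) * ((1) * b - (1) * a)) * ((x) * ((4) * c - ((-1)) * b) - (y) * (((-1)) * c - ((-1)) * a) + (z) * (((-1)) * b - (4) * a)) := by
        nlinarith only [pl2, mul_pos hBNU (by linarith only [hg1, hg2, hg5, hg6] : (0:ℝ) < -(a - b - 5 * c)),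
          mul_pos (by linarith only [h10] : (0:ℝ) < ((2 * c ^ 2 - 2 * b * c + 2 * a * c) * ((4) * c - ((-1)) * b) - (4 - 2 * c ^ 2 + 2 * b * c - b ^ 2 - 2 * a * c - 2 * a * b - a ^ 2) * (((-1)) * c - ((-1)) * a) + (4 + 2 * b * c - 3 * b ^ 2 - 2 * a * c + 2 * a * b - 3 * a ^ 2) * (((-1)) * b - (4) * a))) (neg_pos.2 D3.1)]
      by_contra h
      push Not at h
      nlinarith only [hR, hDk, h]
    have e1 : (x * (1 * c - 0 * b) - y * (1 * c - 0 * a) + z * (1 * b - 1 * a)) = -((1) * ((y) * c - (z) * b) - (1) * ((x) * c - (z) * a) + (0) * ((x) * b - (y) * a)) := by ring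
    have e3 : (1 * (b * z - c * y) + 0 * (c * x - a * z) + 1 * (a * y - b * x)) * ((-1 / 3) * (b * z - c * y) + (4 / 3) * (c * x - a * z) + (-1 / 3) * (a * y - b * x)) = (1 / 3) * ((-((1) * ((y) * c - (z) * b) - (0) * ((x) * c - (z) * a) + (1) * ((x) * b - (y) * a))) * ((x) * ((4) * c - ((-1)) * b) - (y) * (((-1)) * c - ((-1)) * a) + (z) * (((-1)) * b - (4) * a))) := by ring
    refine regionN_false hn hu hg1 hg2 hg3 hg4 hg5 hg6 hg7 hdT hUB1 hUW1 ?_ ?_ ?_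
    · rw [e1]; exact mul_nonneg (neg_nonneg.2 D3.1.le) (by linarith only [h9])
    · exact mul_pos hBNU (by linarith only [h9])
    · rw [e3]; nlinarith only [mul_pos D3.2 hUPN]
  -- D5: strictly after `Z`, strictly before `W₂` — excluded by the caller
  by_cases D5 : ((e₁) * ((y) * c - (z) * b) - (e₂) * ((x) * c - (z) * a) + (e₃) * ((x) * b - (y) * a)) < 0 ∧ 0 < (((-1)) * ((y) * c - (z) * b) - (0) * ((x) * c - (z) * a) + (1) * ((x) * b - (y) * a))
  · exact (hS D5.1 D5.2).elim
  -- coverage: the Plücker relation for `(W₂, B₁, Z, U)`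
  have pl := ar_plucker a b c (-1) 0 1 1 1 0 e₁ e₂ e₃ x y z
  push Not at D1 D2 D3 D5
  rcases le_or_gt (((-1)) * ((y) * c - (z) * b) - (0) * ((x) * c - (z) * a) + (1) * ((x) * b - (y) * a)) 0 with hW2 | hW2
  · have hW1 := D1 hW2
    have hB1 := D2 hW1
    refine ⟨D3 hB1, ?_⟩
    by_contra hZ
    push Not at hZ
    nlinarith only [pl, mul_pos_of_neg_of_neg (show b - a - c < 0 by linarith only [hg1, hg2, hg5, hg6]) hZ,
      mul_pos kWZ (neg_pos.2 hB1), mul_nonneg_of_nonpos_of_nonpos hW2 kBZ.le]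
  · have hZ : 0 ≤ ((e₁) * ((y) * c - (z) * b) - (e₂) * ((x) * c - (z) * a) + (e₃) * ((x) * b - (y) * a)) := by
      by_contra h
      push Not at h
      exact absurd (D5 h) (not_le.2 hW2)
    refine ⟨?_, hZ⟩
    by_contra hB2
    push Not at hB2
    have hB1 : 0 ≤ ((1) * ((y) * c - (z) * b) - (1) * ((x) * c - (z) * a) + (0) * ((x) * b - (y) * a)) := by
      by_contra h
      push Not at h
      exact absurd (D3 h) (not_le.2 hB2)
    have hW1 : 0 ≤ ((0) * ((y) * c - (z) * b) - (1) * ((x) * c - (z) * a) + (1) * ((x) * b - (y) * a)) := by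
      by_contra h
      push Not at h
      exact absurd (D2 h) (not_lt.2 hB1)
    nlinarith only [pl, mul_nonneg (show 0 ≤ -(b - a - c) by linarith only [hg1, hg2, hg5, hg6]) hZ,
      mul_nonneg kWZ.le hB1, mul_pos hW2 (neg_pos.2 kBZ), D1, hW1, hW2]


/-- **Sine addition in the tangent plane:** `ar(X,Y) Q(V,V) = ar(X,V) Q(V,Y) + Q(X,V) ar(V,Y)` (with
`Q(X,Y) = |n|² X·Y − (X·n)(Y·n)`; ring identity). -/
theorem tangent_sin_add (a b c x₁ x₂ x₃ y₁ y₂ y₃ v₁ v₂ v₃ : ℝ) :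
    ((x₁) * ((y₂) * c - (y₃) * b) - (x₂) * ((y₁) * c - (y₃) * a) + (x₃) * ((y₁) * b - (y₂) * a)) * ((a ^ 2 + b ^ 2 + c ^ 2) * ((v₁) * (v₁) + (v₂) * (v₂) + (v₃) * (v₃)) - (a * (v₁) + b * (v₂) + c * (v₃)) * (a * (v₁) + b * (v₂) + c * (v₃))) =
    ((x₁) * ((v₂) * c - (v₃) * b) - (x₂) * ((v₁) * c - (v₃) * a) + (x₃) * ((v₁) * b - (v₂) * a)) * ((a ^ 2 + b ^ 2 + c ^ 2) * ((v₁) * (y₁) + (v₂) * (y₂) + (v₃) * (y₃)) - (a * (v₁) + b * (v₂) + c * (v₃)) * (a * (y₁) + b * (y₂) + c * (y₃))) + ((a ^ 2 + b ^ 2 + c ^ 2) * ((x₁) * (v₁) + (x₂) * (v₂) + (x₃) * (v₃)) - (a * (x₁) + b * (x₂) + c * (x₃)) * (a * (v₁) + b * (v₂) + c * (v₃))) * ((v₁) * ((y₂) * c - (y₃) * b) - (v₂) * ((y₁) * c - (y₃) * a) + (v₃) * ((y₁) * b - (y₂) * a)) := by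
  ring


/-- `ar(W₂, B̃_S) = s_B (a + c − b)` (reduced `s_B`). -/
theorem ar_W2_BS {a b c : ℝ} (hn : a ^ 2 + b ^ 2 + c ^ 2 = 2) :
    (((-1)) * ((-c ^ 2 + 2 * b * c + 2 * b ^ 2 - 2 * a * c + 2 * a * b - a ^ 2) * c - (c ^ 2 + 2 * b * c + 2 * a * c + 2 * a * b + a ^ 2) * b) - (0) * ((2 * b * c - 2 * b ^ 2 + 2 * a * b) * c - (c ^ 2 + 2 * b * c + 2 * a * c + 2 * a * b + a ^ 2) * a) + (1) * ((2 * b * c - 2 * b ^ 2 + 2 * a * b) * b - (-c ^ 2 + 2 * b * c + 2 * b ^ 2 - 2 * a * c + 2 * a * b - a ^ 2) * a)) = (2 + b ^ 2 + 2 * a * c) * (a + c - b) := by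
  linear_combination (c - b + a) * hn

/-- `ar(W₂, B̃_S) > 0`: `B_S` is strictly before `W₂`. -/
theorem ar_W2_BS_pos {a b c : ℝ} (hn : a ^ 2 + b ^ 2 + c ^ 2 = 2) (hg1 : 0 ≤ -b + a) (hg2 : 0 ≤ b + a)
    (hg3 : 0 ≤ -209 + 256 * c + 256 * b - 256 * a) (hg4 : 0 ≤ 2 - c ^ 2 - 2 * b * c - b ^ 2) (hg5 : 0 ≤ 5 - 8 * a)
    (hg6 : 0 ≤ -9 + 8 * c) : 0 < (((-1)) * ((-c ^ 2 + 2 * b * c + 2 * b ^ 2 - 2 * a * c + 2 * a * b - a ^ 2) * c - (c ^ 2 + 2 * b * c + 2 * a * c + 2 * a * b + a ^ 2) * b) - (0) * ((2 * b * c - 2 * b ^ 2 + 2 * a * b) * c - (c ^ 2 + 2 * b * c + 2 * a * c + 2 * a * b + a ^ 2) * a) + (1) * ((2 * b * c - 2 * b ^ 2 + 2 * a * b) * b - (-c ^ 2 + 2 * b * c + 2 * b ^ 2 - 2 * a * c + 2 * a * b - a ^ 2) * a)) := by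
  have hT0 : 1 < b + c := by have := cert_T0m1 hn hg1 hg2 hg3 hg4; linarith only [this]
  have hsB : (0:ℝ) < 2 + b ^ 2 + 2 * a * c := by nlinarith only [hg5, hg6, hg1, hg2, sq_nonneg b]
  rw [ar_W2_BS hn]; exact mul_pos hsB (by linarith only [hT0, hg5, hg1])

/-- `ar(B₁, B̃_S) < 0`: `B₁` is strictly before `B_S` (`cert_covB`). -/
theorem ar_B1_BS_neg {a b c : ℝ} (hn : a ^ 2 + b ^ 2 + c ^ 2 = 2) (hg1 : 0 ≤ -b + a) (hg2 : 0 ≤ b + a) (hg3 : 0 ≤ -209 + 256 * c + 256 * b - 256 * a) (hg4 : 0 ≤ 2 - c ^ 2 - 2 * b * c - b ^ 2) :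
    ((1) * ((-c ^ 2 + 2 * b * c + 2 * b ^ 2 - 2 * a * c + 2 * a * b - a ^ 2) * c - (c ^ 2 + 2 * b * c + 2 * a * c + 2 * a * b + a ^ 2) * b) - (1) * ((2 * b * c - 2 * b ^ 2 + 2 * a * b) * c - (c ^ 2 + 2 * b * c + 2 * a * c + 2 * a * b + a ^ 2) * a) + (0) * ((2 * b * c - 2 * b ^ 2 + 2 * a * b) * b - (-c ^ 2 + 2 * b * c + 2 * b ^ 2 - 2 * a * c + 2 * a * b - a ^ 2) * a)) < 0 := by
  have e : ((1) * ((-c ^ 2 + 2 * b * c + 2 * b ^ 2 - 2 * a * c + 2 * a * b - a ^ 2) * c - (c ^ 2 + 2 * b * c + 2 * a * c + 2 * a * b + a ^ 2) * b) - (1) * ((2 * b * c - 2 * b ^ 2 + 2 * a * b) * c - (c ^ 2 + 2 * b * c + 2 * a * c + 2 * a * b + a ^ 2) * a) + (0) * ((2 * b * c - 2 * b ^ 2 + 2 * a * b) * b - (-c ^ 2 + 2 * b * c + 2 * b ^ 2 - 2 * a * c + 2 * a * b - a ^ 2) * a)) = (-2 * c - 2 * b + 3 * b ^ 2 * c + b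 ^ 3 - 2 * a - a * b ^ 2 + 2 * a ^ 2 * c + 2 * a ^ 2 * b + 2 * a ^ 3) + (-c - b - a) * (a ^ 2 + b ^ 2 + c ^ 2 - 2) := by ring
  have hh : a ^ 2 + b ^ 2 + c ^ 2 - 2 = 0 := by linarith only [hn]
  have hc := cert_covB hn hg1 hg2 hg3 hg4
  rw [e, hh, mul_zero, add_zero]; linarith only [hc]

/-- `ar(B̃_S, W₃) < 0` (`cert_f6`): (M2) for the south template. -/
theorem ar_BS_W3_neg {a b c : ℝ} (hn : a ^ 2 + b ^ 2 + c ^ 2 = 2) (hg1 : 0 ≤ -b + a) (hg2 : 0 ≤ b + a) (hg3 : 0 ≤ -209 + 256 * c + 256 * b - 256 * a) (hg4 : 0 ≤ 2 - c ^ 2 - 2 * b * c - b ^ 2) :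
    ((2 * b * c - 2 * b ^ 2 + 2 * a * b) * ((1) * c - (0) * b) - (-c ^ 2 + 2 * b * c + 2 * b ^ 2 - 2 * a * c + 2 * a * b - a ^ 2) * (((-1)) * c - (0) * a) + (c ^ 2 + 2 * b * c + 2 * a * c + 2 * a * b + a ^ 2) * (((-1)) * b - (1) * a)) < 0 := by
  have e : ((2 * b * c - 2 * b ^ 2 + 2 * a * b) * ((1) * c - (0) * b) - (-c ^ 2 + 2 * b * c + 2 * b ^ 2 - 2 * a * c + 2 * a * b - a ^ 2) * (((-1)) * c - (0) * a) + (c ^ 2 + 2 * b * c + 2 * a * c + 2 * a * b + a ^ 2) * (((-1)) * b - (1) * a)) = (-2 * c + 6 * b - b ^ 2 * c - 3 * b ^ 3 - 6 * a + a * b ^ 2 - 2 * a ^ 2 * c - 6 * a ^ 2 * b + 2 * a ^ 3) + (-c + 3 * b - 3 * a) * (a ^ 2 + b ^ 2 + c ^ 2 - 2) := by ring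
  have hh : a ^ 2 + b ^ 2 + c ^ 2 - 2 = 0 := by linarith only [hn]
  have hc := cert_f6 hn hg1 hg2 hg3 hg4
  rw [e, hh, mul_zero, add_zero]; linarith only [hc]


/-- **South exclusion.**  A contact strictly after the south end with `ar(B̃_S, U) < 0` and strictly
before `W₂` (`0 < ar(W₂, U)`), the tangent case data `ar(U,P̃*) > 0` being derived from a point `R`
before `U` with `ar(R,P̃*)`… — concretely: given `ar(B̃_S,U) < 0 < ar(W₂,U)` and `ar(U, P̃*) > 0`, the
south template applies. -/
theorem south_exclusion {a b c x y z : ℝ} (hn : a ^ 2 + b ^ 2 + c ^ 2 = 2) (hu : x ^ 2 + y ^ 2 + z ^ 2 = 2)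
    (hg1 : 0 ≤ -b + a) (hg2 : 0 ≤ b + a) (hg3 : 0 ≤ -209 + 256 * c + 256 * b - 256 * a)
    (hg4 : 0 ≤ 2 - c ^ 2 - 2 * b * c - b ^ 2) (hg5 : 0 ≤ 5 - 8 * a) (hg6 : 0 ≤ -9 + 8 * c)
    (hdT : b + c < a * x + b * y + c * z) (hUW1 : y + z ≤ 1) (hUW2 : -x + z ≤ 1)
    (hZB : ((2 * b * c - 2 * b ^ 2 + 2 * a * b) * (y * c - z * b) - (-c ^ 2 + 2 * b * c + 2 * b ^ 2 - 2 * a * c + 2 * a * b - a ^ 2) * (x * c - z * a) + (c ^ 2 + 2 * b * c + 2 * a * c + 2 * a * b + a ^ 2) * (x * b - y * a)) < 0) (hW2 : 0 < (((-1)) * ((y) * c - (z) * b) - (0) * ((x) * c - (z) * a) + (1) * ((x) * b - (y) * a))) (hP : 0 < ((x) * (((-1)) * c - (4) * b) - (y) * ((1) * c - (4) * a) + (z) * ((1) * b - ((-1)) * a))) : False := by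
  have kWB := ar_W2_BS_pos hn hg1 hg2 hg3 hg4 hg5 hg6
  have eD : ((2 * b * c - 2 * b ^ 2 + 2 * a * b) * (0 * c - 1 * b) - (-c ^ 2 + 2 * b * c + 2 * b ^ 2 - 2 * a * c + 2 * a * b - a ^ 2) * ((-1) * c - 1 * a) + (c ^ 2 + 2 * b * c + 2 * a * c + 2 * a * b + a ^ 2) * ((-1) * b - 0 * a)) = -(((-1)) * ((-c ^ 2 + 2 * b * c + 2 * b ^ 2 - 2 * a * c + 2 * a * b - a ^ 2) * c - (c ^ 2 + 2 * b * c + 2 * a * c + 2 * a * b + a ^ 2) * b) - (0) * ((2 * b * c - 2 * b ^ 2 + 2 * a * b) * c - (c ^ 2 + 2 * b * c + 2 * a * c + 2 * a * b + a ^ 2) * a) + (1) * ((2 * b * c - 2 * b ^ 2 + 2 * a * b) * b - (-c ^ 2 + 2 * b * c + 2 * b ^ 2 - 2 * a * c + 2 * a * b - a ^ 2) * a)) := by ring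
  have hDk : ((2 * b * c - 2 * b ^ 2 + 2 * a * b) * (0 * c - 1 * b) - (-c ^ 2 + 2 * b * c + 2 * b ^ 2 - 2 * a * c + 2 * a * b - a ^ 2) * ((-1) * c - 1 * a) + (c ^ 2 + 2 * b * c + 2 * a * c + 2 * a * b + a ^ 2) * ((-1) * b - 0 * a)) < 0 := by rw [eD]; exact neg_neg_of_pos kWB
  have eL : (x * (0 * c - 1 * b) - y * ((-1) * c - 1 * a) + z * ((-1) * b - 0 * a)) = -(((-1)) * ((y) * c - (z) * b) - (0) * ((x) * c - (z) * a) + (1) * ((x) * b - (y) * a)) := by ring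
  have hf6 := ar_BS_W3_neg hn hg1 hg2 hg3 hg4
  have pl2 := ar_plucker a b c (2 * b * c - 2 * b ^ 2 + 2 * a * b) (-c ^ 2 + 2 * b * c + 2 * b ^ 2 - 2 * a * c + 2 * a * b - a ^ 2) (c ^ 2 + 2 * b * c + 2 * a * c + 2 * a * b + a ^ 2) (-1) 0 1 x y z (-1) 1 0
  have hW3 : ((x) * ((1) * c - (0) * b) - (y) * (((-1)) * c - (0) * a) + (z) * (((-1)) * b - (1) * a)) < 0 := by
    have hR : 0 < ((2 * b * c - 2 * b ^ 2 + 2 * a * b) * ((0) * c - (1) * b) - (-c ^ 2 + 2 * b * c + 2 * b ^ 2 - 2 * a * c + 2 * a * b - a ^ 2) * (((-1)) * c - (1) * a) + (c ^ 2 + 2 * b * c + 2 * a * c + 2 * a * b + a ^ 2) * (((-1)) * b - (0) * a)) * ((x) * ((1) * c - (0) * b) - (y) * (((-1)) * c - (0) * a) + (z) * (((-1)) * b - (1) * a)) := by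
      nlinarith only [pl2, mul_pos_of_neg_of_neg hZB (by linarith only [hg1, hg2, hg6] : (((-1)) * ((1) * c - (0) * b) - (0) * (((-1)) * c - (0) * a) + (1) * (((-1)) * b - (1) * a)) < 0),
        mul_pos (by linarith only [hf6] : (0:ℝ) < -((2 * b * c - 2 * b ^ 2 + 2 * a * b) * ((1) * c - (0) * b) - (-c ^ 2 + 2 * b * c + 2 * b ^ 2 - 2 * a * c + 2 * a * b - a ^ 2) * (((-1)) * c - (0) * a) + (c ^ 2 + 2 * b * c + 2 * a * c + 2 * a * b + a ^ 2) * (((-1)) * b - (1) * a))) hW2]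
    by_contra h
    push Not at h
    nlinarith only [hR, mul_nonpos_iff.2 (Or.inr ⟨(by linarith only [hDk, eD] : ((2 * b * c - 2 * b ^ 2 + 2 * a * b) * ((0) * c - (1) * b) - (-c ^ 2 + 2 * b * c + 2 * b ^ 2 - 2 * a * c + 2 * a * b - a ^ 2) * (((-1)) * c - (1) * a) + (c ^ 2 + 2 * b * c + 2 * a * c + 2 * a * b + a ^ 2) * (((-1)) * b - (0) * a)) ≤ 0), h⟩)]
  have esep : ((1 / 3) * (b * z - c * y) + (-1 / 3) * (c * x - a * z) + (4 / 3) * (a * y - b * x)) * ((-1) * (b * z - c * y) + 1 * (c * x - a * z) + 0 * (a * y - b * x)) = (1 / 3) * (((x) * (((-1)) * c - (4) * b) - (y) * ((1) * c - (4) * a) + (z) * ((1) * b - ((-1)) * a)) * ((x) * ((1) * c - (0) * b) - (y) * (((-1)) * c - (0) * a) + (z) * (((-1)) * b - (1) * a))) := by ring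
  refine regionS_false hn hu hg1 hg2 hg3 hg4 hg5 hg6 hdT hUW2 hUW1 ?_ ?_ ?_
  · rw [eL]; exact mul_nonneg_of_nonpos_of_nonpos (neg_nonpos.2 hW2.le) hDk.le
  · exact mul_pos_of_neg_of_neg hZB hDk
  · rw [esep]; nlinarith only [mul_neg_of_pos_of_neg hP hW3]


/-- **Survivor, case B** (`ar(B̃_S,P̃*) ≥ 0`, polynomial form `hgB`: the south end is `Z = B̃_S`).
A contact of depth `> T₀` avoiding the caps of `W₁, W₂, B₁` satisfies `ar(B₂,U) ≤ 0 ≤ ar(B̃_S,U)`. -/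
theorem survivorB {a b c x y z : ℝ} (hn : a ^ 2 + b ^ 2 + c ^ 2 = 2) (hu : x ^ 2 + y ^ 2 + z ^ 2 = 2)
    (hg1 : 0 ≤ -b + a) (hg2 : 0 ≤ b + a) (hg3 : 0 ≤ -209 + 256 * c + 256 * b - 256 * a)
    (hg4 : 0 ≤ 2 - c ^ 2 - 2 * b * c - b ^ 2) (hg5 : 0 ≤ 5 - 8 * a) (hg6 : 0 ≤ -9 + 8 * c) (hg7 : 0 ≤ 5 - 16 * b)
    (hII : (b + c) ^ 2 < 2) (hgB : 0 ≤ c ^ 3 - 3 * b * c ^ 2 - 6 * b ^ 2 * c + 8 * b ^ 3 - a * c ^ 2 + 8 * a * b * c + 2 * a * b ^ 2 - 5 * a ^ 2 * c + 11 * a ^ 2 * b - 3 * a ^ 3)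
    (hdT : b + c < a * x + b * y + c * z) (hUW1 : y + z ≤ 1) (hUW2 : -x + z ≤ 1) (hUB1 : x + y ≤ 1) :
    ((1) * ((y) * c - (z) * b) - (0) * ((x) * c - (z) * a) + (1) * ((x) * b - (y) * a)) ≤ 0 ∧ 0 ≤ ((2 * b * c - 2 * b ^ 2 + 2 * a * b) * ((y) * c - (z) * b) - (-c ^ 2 + 2 * b * c + 2 * b ^ 2 - 2 * a * c + 2 * a * b - a ^ 2) * ((x) * c - (z) * a) + (c ^ 2 + 2 * b * c + 2 * a * c + 2 * a * b + a ^ 2) * ((x) * b - (y) * a)) := by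
  have kWZ := ar_W2_BS_pos hn hg1 hg2 hg3 hg4 hg5 hg6
  have kBZ := ar_B1_BS_neg hn hg1 hg2 hg3 hg4
  refine survivor_core hn hu hg1 hg2 hg3 hg4 hg5 hg6 hg7 hII hdT hUW1 hUW2 hUB1 kWZ kBZ ?_
  intro hZ hW2
  have hgB2 : (0 : ℝ) ≤ ((2 * b * c - 2 * b ^ 2 + 2 * a * b) * (((-1)) * c - (4) * b) - (-c ^ 2 + 2 * b * c + 2 * b ^ 2 - 2 * a * c + 2 * a * b - a ^ 2) * ((1) * c - (4) * a) + (c ^ 2 + 2 * b * c + 2 * a * c + 2 * a * b + a ^ 2) * ((1) * b - ((-1)) * a)) := by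
    have e : ((2 * b * c - 2 * b ^ 2 + 2 * a * b) * (((-1)) * c - (4) * b) - (-c ^ 2 + 2 * b * c + 2 * b ^ 2 - 2 * a * c + 2 * a * b - a ^ 2) * ((1) * c - (4) * a) + (c ^ 2 + 2 * b * c + 2 * a * c + 2 * a * b + a ^ 2) * ((1) * b - ((-1)) * a)) = c ^ 3 - 3 * b * c ^ 2 - 6 * b ^ 2 * c + 8 * b ^ 3 - a * c ^ 2 + 8 * a * b * c + 2 * a * b ^ 2 - 5 * a ^ 2 * c + 11 * a ^ 2 * b - 3 * a ^ 3 := by ring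
    rw [e]; exact hgB
  have hf4 := fact_f4 hn hg1 hg2 hg3 hg6
  have pl1 := ar_plucker a b c (2 * b * c - 2 * b ^ 2 + 2 * a * b) (-c ^ 2 + 2 * b * c + 2 * b ^ 2 - 2 * a * c + 2 * a * b - a ^ 2) (c ^ 2 + 2 * b * c + 2 * a * c + 2 * a * b + a ^ 2) (-1) 0 1 x y z 1 (-1) 4
  have hP : 0 < ((x) * (((-1)) * c - (4) * b) - (y) * ((1) * c - (4) * a) + (z) * ((1) * b - ((-1)) * a)) := by
    have hR : ((2 * b * c - 2 * b ^ 2 + 2 * a * b) * ((0) * c - (1) * b) - (-c ^ 2 + 2 * b * c + 2 * b ^ 2 - 2 * a * c + 2 * a * b - a ^ 2) * (((-1)) * c - (1) * a) + (c ^ 2 + 2 * b * c + 2 * a * c + 2 * a * b + a ^ 2) * (((-1)) * b - (0) * a)) * ((x) * (((-1)) * c - (4) * b) - (y) * ((1) * c - (4) * a) + (z) * ((1) * b - ((-1)) * a)) < 0 := by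
      nlinarith only [pl1, mul_neg_of_neg_of_pos hZ (by linarith only [hf4] : (0:ℝ) < (((-1)) * (((-1)) * c - (4) * b) - (0) * ((1) * c - (4) * a) + (1) * ((1) * b - ((-1)) * a))), mul_nonneg hgB2 hW2.le]
    by_contra h
    push Not at h
    nlinarith only [hR, mul_nonneg_of_nonpos_of_nonpos (by linarith only [kWZ] : ((2 * b * c - 2 * b ^ 2 + 2 * a * b) * ((0) * c - (1) * b) - (-c ^ 2 + 2 * b * c + 2 * b ^ 2 - 2 * a * c + 2 * a * b - a ^ 2) * (((-1)) * c - (1) * a) + (c ^ 2 + 2 * b * c + 2 * a * c + 2 * a * b + a ^ 2) * (((-1)) * b - (0) * a)) ≤ 0) h]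
  exact south_exclusion hn hu hg1 hg2 hg3 hg4 hg5 hg6 hdT hUW1 hUW2 hZ hW2 hP


/-- case A: `ar(W₂, Z̃_S) > 0`: the south end `Z_S` is strictly before `W₂` (`fact_ZSW2`). -/
theorem ar_W2_ZS_pos {a b c : ℝ} (hn : a ^ 2 + b ^ 2 + c ^ 2 = 2) (hg1 : 0 ≤ -b + a) (hg2 : 0 ≤ b + a) (hg3 : 0 ≤ -209 + 256 * c + 256 * b - 256 * a) (hg4 : 0 ≤ 2 - c ^ 2 - 2 * b * c - b ^ 2) (hg5 : 0 ≤ 5 - 8 * a) (hg6 : 0 ≤ -9 + 8 * c) (hgA : 0 ≤ -c ^ 3 + 3 * b * c ^ 2 + 6 * b ^ 2 * c - 8 * b ^ 3 + a * c ^ 2 - 8 * a * b * c - 2 * a * b ^ 2 + 5 * a ^ 2 * c - 11 * a ^ 2 * b + 3 * a ^ 3) :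
    0 < (((-1)) * ((-35 * c ^ 2 + 62 * b * c + 61 * b ^ 2 - 48 * a * c + 72 * a * b - 14 * a ^ 2) * c - (37 * c ^ 2 + 62 * b * c - 11 * b ^ 2 + 72 * a * c + 48 * a * b + 34 * a ^ 2) * b) - (0) * ((-12 * c ^ 2 + 72 * b * c - 60 * b ^ 2 - 8 * a * c + 40 * a * b) * c - (37 * c ^ 2 + 62 * b * c - 11 * b ^ 2 + 72 * a * c + 48 * a * b + 34 * a ^ 2) * a) + (1) * ((-12 * c ^ 2 + 72 * b * c - 60 * b ^ 2 - 8 * a * c + 40 * a * b) * b - (-35 * c ^ 2 + 62 * b * c + 61 * b ^ 2 - 48 * a * c + 72 * a * b - 14 * a ^ 2) * a)) := by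
  have hgAr : 0 ≤ -2 * c + 6 * b + 7 * b ^ 2 * c - 11 * b ^ 3 + 2 * a - 8 * a * b * c - 3 * a * b ^ 2 + 6 * a ^ 2 * c - 14 * a ^ 2 * b + 2 * a ^ 3 := by
    have e : -2 * c + 6 * b + 7 * b ^ 2 * c - 11 * b ^ 3 + 2 * a - 8 * a * b * c - 3 * a * b ^ 2 + 6 * a ^ 2 * c - 14 * a ^ 2 * b + 2 * a ^ 3 = (-c ^ 3 + 3 * b * c ^ 2 + 6 * b ^ 2 * c - 8 * b ^ 3 + a * c ^ 2 - 8 * a * b * c - 2 * a * b ^ 2 + 5 * a ^ 2 * c - 11 * a ^ 2 * b + 3 * a ^ 3) + (c - 3 * b - a) * (a ^ 2 + b ^ 2 + c ^ 2 - 2) := by ring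
    have hh : a ^ 2 + b ^ 2 + c ^ 2 - 2 = 0 := by linarith only [hn]
    rw [e, hh, mul_zero, add_zero]; exact hgA
  have e : (((-1)) * ((-35 * c ^ 2 + 62 * b * c + 61 * b ^ 2 - 48 * a * c + 72 * a * b - 14 * a ^ 2) * c - (37 * c ^ 2 + 62 * b * c - 11 * b ^ 2 + 72 * a * c + 48 * a * b + 34 * a ^ 2) * b) - (0) * ((-12 * c ^ 2 + 72 * b * c - 60 * b ^ 2 - 8 * a * c + 40 * a * b) * c - (37 * c ^ 2 + 62 * b * c - 11 * b ^ 2 + 72 * a * c + 48 * a * b + 34 * a ^ 2) * a) + (1) * ((-12 * c ^ 2 + 72 * b * c - 60 * b ^ 2 - 8 * a * c + 40 * a * b) * b - (-35 * c ^ 2 + 62 * b * c + 61 * b ^ 2 - 48 * a * c + 72 * a * b - 14 * a ^ 2) * a)) = (70 * c - 74 * b + 38 * b ^ 2 * c - 34 * b ^ 3 + 166 * a - 70 * a * b * c - 56 * a * b ^ 2 + 27 * a ^ 2 * c - a ^ 2 * b - 69 * a ^ 3) + (35 * c - 37 * b + 83 * a) * (a ^ 2 + b ^ 2 + c ^ 2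 - 2) := by ring
  have hh : a ^ 2 + b ^ 2 + c ^ 2 - 2 = 0 := by linarith only [hn]
  have hc := fact_ZSW2 hn hg1 hg2 hg3 hg4 hg5 hg6 hgAr
  rw [e, hh, mul_zero, add_zero]; linarith only [hc]

/-- case A: `ar(B₁, Z̃_S) < 0` (`cert_B1ZS`). -/
theorem ar_B1_ZS_neg {a b c : ℝ} (hn : a ^ 2 + b ^ 2 + c ^ 2 = 2) (hg1 : 0 ≤ -b + a) (hg2 : 0 ≤ b + a) (hg3 : 0 ≤ -209 + 256 * c + 256 * b - 256 * a) (hg4 : 0 ≤ 2 - c ^ 2 - 2 * b * c - b ^ 2) :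
    ((1) * ((-35 * c ^ 2 + 62 * b * c + 61 * b ^ 2 - 48 * a * c + 72 * a * b - 14 * a ^ 2) * c - (37 * c ^ 2 + 62 * b * c - 11 * b ^ 2 + 72 * a * c + 48 * a * b + 34 * a ^ 2) * b) - (1) * ((-12 * c ^ 2 + 72 * b * c - 60 * b ^ 2 - 8 * a * c + 40 * a * b) * c - (37 * c ^ 2 + 62 * b * c - 11 * b ^ 2 + 72 * a * c + 48 * a * b + 34 * a ^ 2) * a) + (0) * ((-12 * c ^ 2 + 72 * b * c - 60 * b ^ 2 - 8 * a * c + 40 * a * b) * b - (-35 * c ^ 2 + 62 * b * c + 61 * b ^ 2 - 48 * a * c + 72 * a * b - 14 * a ^ 2) * a)) < 0 := by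
  have e : ((1) * ((-35 * c ^ 2 + 62 * b * c + 61 * b ^ 2 - 48 * a * c + 72 * a * b - 14 * a ^ 2) * c - (37 * c ^ 2 + 62 * b * c - 11 * b ^ 2 + 72 * a * c + 48 * a * b + 34 * a ^ 2) * b) - (1) * ((-12 * c ^ 2 + 72 * b * c - 60 * b ^ 2 - 8 * a * c + 40 * a * b) * c - (37 * c ^ 2 + 62 * b * c - 11 * b ^ 2 + 72 * a * c + 48 * a * b + 34 * a ^ 2) * a) + (0) * ((-12 * c ^ 2 + 72 * b * c - 60 * b ^ 2 - 8 * a * c + 40 * a * b) * b - (-35 * c ^ 2 + 62 * b * c + 61 * b ^ 2 - 48 * a * c + 72 * a * b - 14 * a ^ 2) * a)) = (-46 * c - 94 * b + 82 * b ^ 2 * c + 58 * b ^ 3 - 6 * a + 22 * a * b * c - 56 * a * b ^ 2 + 81 * a ^ 2 * c + 61 * a ^ 2 * b + 37 * a ^ 3) + (-23 * c - 47 * b - 3 * a) * (a ^ 2 + b ^ 2 + c ^ 2 - 2) := by ring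
  have hh : a ^ 2 + b ^ 2 + c ^ 2 - 2 = 0 := by linarith only [hn]
  have hc := cert_B1ZS hn hg1 hg2 hg3 hg4
  rw [e, hh, mul_zero, add_zero]; linarith only [hc]

/-- case A: `ar(P̃*, Z̃_S) < 0`: `P*` is strictly before `Z_S` (`cert_PsZS`). -/
theorem ar_Ps_ZS_neg {a b c : ℝ} (hn : a ^ 2 + b ^ 2 + c ^ 2 = 2) (hg1 : 0 ≤ -b + a) (hg2 : 0 ≤ b + a) (hg3 : 0 ≤ -209 + 256 * c + 256 * b - 256 * a) (hg4 : 0 ≤ 2 - c ^ 2 - 2 * b * c - b ^ 2) :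
    ((1) * ((-35 * c ^ 2 + 62 * b * c + 61 * b ^ 2 - 48 * a * c + 72 * a * b - 14 * a ^ 2) * c - (37 * c ^ 2 + 62 * b * c - 11 * b ^ 2 + 72 * a * c + 48 * a * b + 34 * a ^ 2) * b) - ((-1)) * ((-12 * c ^ 2 + 72 * b * c - 60 * b ^ 2 - 8 * a * c + 40 * a * b) * c - (37 * c ^ 2 + 62 * b * c - 11 * b ^ 2 + 72 * a * c + 48 * a * b + 34 * a ^ 2) * a) + (4) * ((-12 * c ^ 2 + 72 * b * c - 60 * b ^ 2 - 8 * a * c + 40 * a * b) * b - (-35 * c ^ 2 + 62 * b * c + 61 * b ^ 2 - 48 * a * c + 72 * a * b - 14 * a ^ 2) * a)) < 0 := by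
  have e : ((1) * ((-35 * c ^ 2 + 62 * b * c + 61 * b ^ 2 - 48 * a * c + 72 * a * b - 14 * a ^ 2) * c - (37 * c ^ 2 + 62 * b * c - 11 * b ^ 2 + 72 * a * c + 48 * a * b + 34 * a ^ 2) * b) - ((-1)) * ((-12 * c ^ 2 + 72 * b * c - 60 * b ^ 2 - 8 * a * c + 40 * a * b) * c - (37 * c ^ 2 + 62 * b * c - 11 * b ^ 2 + 72 * a * c + 48 * a * b + 34 * a ^ 2) * a) + (4) * ((-12 * c ^ 2 + 72 * b * c - 60 * b ^ 2 - 8 * a * c + 40 * a * b) * b - (-35 * c ^ 2 + 62 * b * c + 61 * b ^ 2 - 48 * a * c + 72 * a * b - 14 * a ^ 2) * a)) = (-94 * c + 98 * b + 274 * b ^ 2 * c - 278 * b ^ 3 + 94 * a - 302 * a * b * c - 168 * a * b ^ 2 + 153 * a ^ 2 * c - 419 * a ^ 2 * b - 25 * a ^ 3) + (-47 * c + 49 * b + 47 * a) * (a ^ 2 + b ^ 2 + c ^ 2 - 2) := by ring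
  have hh : a ^ 2 + b ^ 2 + c ^ 2 - 2 = 0 := by linarith only [hn]
  have hc := cert_PsZS hn hg1 hg2 hg3 hg4
  rw [e, hh, mul_zero, add_zero]; linarith only [hc]


/-- case A: `ar(B̃_S, Z̃_S) < 0`: `B_S ≺ P* ≺ Z_S`, all strictly before `W₂` (Plücker relation). -/
theorem ar_BS_ZS_neg {a b c : ℝ} (hn : a ^ 2 + b ^ 2 + c ^ 2 = 2) (hg1 : 0 ≤ -b + a) (hg2 : 0 ≤ b + a) (hg3 : 0 ≤ -209 + 256 * c + 256 * b - 256 * a) (hg4 : 0 ≤ 2 - c ^ 2 - 2 * b * c - b ^ 2) (hg5 : 0 ≤ 5 - 8 * a) (hg6 : 0 ≤ -9 + 8 * c) (hgA : 0 ≤ -c ^ 3 + 3 * b * c ^ 2 + 6 * b ^ 2 * c - 8 * b ^ 3 + a * c ^ 2 - 8 * a * b * c - 2 * a * b ^ 2 + 5 * a ^ 2 * c - 11 * a ^ 2 * b + 3 * a ^ 3) :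
    ((2 * b * c - 2 * b ^ 2 + 2 * a * b) * ((-35 * c ^ 2 + 62 * b * c + 61 * b ^ 2 - 48 * a * c + 72 * a * b - 14 * a ^ 2) * c - (37 * c ^ 2 + 62 * b * c - 11 * b ^ 2 + 72 * a * c + 48 * a * b + 34 * a ^ 2) * b) - (-c ^ 2 + 2 * b * c + 2 * b ^ 2 - 2 * a * c + 2 * a * b - a ^ 2) * ((-12 * c ^ 2 + 72 * b * c - 60 * b ^ 2 - 8 * a * c + 40 * a * b) * c - (37 * c ^ 2 + 62 * b * c - 11 * b ^ 2 + 72 * a * c + 48 * a * b + 34 * a ^ 2) * a) + (c ^ 2 + 2 * b * c + 2 * a * c + 2 * a * b + a ^ 2) * ((-12 * c ^ 2 + 72 * b * c - 60 * b ^ 2 - 8 * a * c + 40 * a * b) * b - (-35 * c ^ 2 + 62 * b * c + 61 * b ^ 2 - 48 * a * c + 72 * a * b - 14 * a ^ 2) * a)) < 0 := by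
  have hBP : ((2 * b * c - 2 * b ^ 2 + 2 * a * b) * (((-1)) * c - (4) * b) - (-c ^ 2 + 2 * b * c + 2 * b ^ 2 - 2 * a * c + 2 * a * b - a ^ 2) * ((1) * c - (4) * a) + (c ^ 2 + 2 * b * c + 2 * a * c + 2 * a * b + a ^ 2) * ((1) * b - ((-1)) * a)) ≤ (0 : ℝ) := by
    have e : ((2 * b * c - 2 * b ^ 2 + 2 * a * b) * (((-1)) * c - (4) * b) - (-c ^ 2 + 2 * b * c + 2 * b ^ 2 - 2 * a * c + 2 * a * b - a ^ 2) * ((1) * c - (4) * a) + (c ^ 2 + 2 * b * c + 2 * a * c + 2 * a * b + a ^ 2) * ((1) * b - ((-1)) * a)) = -(-c ^ 3 + 3 * b * c ^ 2 + 6 * b ^ 2 * c - 8 * b ^ 3 + a * c ^ 2 - 8 * a * b * c - 2 * a * b ^ 2 + 5 * a ^ 2 * c - 11 * a ^ 2 * b + 3 * a ^ 3) := by ring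
    rw [e]; linarith only [hgA]
  have kWB := ar_W2_BS_pos hn hg1 hg2 hg3 hg4 hg5 hg6
  have kWZ := ar_W2_ZS_pos hn hg1 hg2 hg3 hg4 hg5 hg6 hgA
  have hPZ := ar_Ps_ZS_neg hn hg1 hg2 hg3 hg4
  have hPW : ((1) * ((0) * c - (1) * b) - ((-1)) * (((-1)) * c - (1) * a) + (4) * (((-1)) * b - (0) * a)) < 0 := by have := fact_f4 hn hg1 hg2 hg3 hg6; linarith only [this]
  have pl0 := ar_plucker a b c (2 * b * c - 2 * b ^ 2 + 2 * a * b) (-c ^ 2 + 2 * b * c + 2 * b ^ 2 - 2 * a * c + 2 * a * b - a ^ 2) (c ^ 2 + 2 * b * c + 2 * a * c + 2 * a * b + a ^ 2) 1 (-1) 4 (-12 * c ^ 2 + 72 * b * c - 60 * b ^ 2 - 8 * a * c + 40 * a * b) (-35 * c ^ 2 + 62 * b * c + 61 * b ^ 2 - 48 * a * c + 72 * a * b - 14 * a ^ 2) (37 * c ^ 2 + 62 * b * c - 11 * b ^ 2 + 72 * a * c + 48 * a * b + 34 * a ^ 2) (-1) 0 1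
  have hR : 0 < ((2 * b * c - 2 * b ^ 2 + 2 * a * b) * ((-35 * c ^ 2 + 62 * b * c + 61 * b ^ 2 - 48 * a * c + 72 * a * b - 14 * a ^ 2) * c - (37 * c ^ 2 + 62 * b * c - 11 * b ^ 2 + 72 * a * c + 48 * a * b + 34 * a ^ 2) * b) - (-c ^ 2 + 2 * b * c + 2 * b ^ 2 - 2 * a * c + 2 * a * b - a ^ 2) * ((-12 * c ^ 2 + 72 * b * c - 60 * b ^ 2 - 8 * a * c + 40 * a * b) * c - (37 * c ^ 2 + 62 * b * c - 11 * b ^ 2 + 72 * a * c + 48 * a * b + 34 * a ^ 2) * a) + (c ^ 2 + 2 * b * c + 2 * a * c + 2 * a * b + a ^ 2) * ((-12 * c ^ 2 + 72 * b * c - 60 * b ^ 2 - 8 * a * c + 40 * a * b) * b - (-35 * c ^ 2 + 62 * b * c + 61 * b ^ 2 - 48 * a * c + 72 * a * b - 14 * a ^ 2) * a)) * ((1) * ((0) * c - (1) * b) - ((-1)) * (((-1)) * c - (1) * a) + (4) * (((-1)) * b - (0) * a)) := by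
    nlinarith only [pl0, mul_nonneg_of_nonpos_of_nonpos hBP (by linarith only [kWZ] : ((-12 * c ^ 2 + 72 * b * c - 60 * b ^ 2 - 8 * a * c + 40 * a * b) * ((0) * c - (1) * b) - (-35 * c ^ 2 + 62 * b * c + 61 * b ^ 2 - 48 * a * c + 72 * a * b - 14 * a ^ 2) * (((-1)) * c - (1) * a) + (37 * c ^ 2 + 62 * b * c - 11 * b ^ 2 + 72 * a * c + 48 * a * b + 34 * a ^ 2) * (((-1)) * b - (0) * a)) ≤ 0),
      mul_pos_of_neg_of_neg (by linarith only [kWB] : ((2 * b * c - 2 * b ^ 2 + 2 * a * b) * ((0) * c - (1) * b) - (-c ^ 2 + 2 * b * c + 2 * b ^ 2 - 2 * a * c + 2 * a * b - a ^ 2) * (((-1)) * c - (1) * a) + (c ^ 2 + 2 * b * c + 2 * a * c + 2 * a * b + a ^ 2) * (((-1)) * b - (0) * a)) < 0) hPZ]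
  by_contra h
  push Not at h
  nlinarith only [hR, mul_nonpos_iff.2 (Or.inl ⟨h, hPW.le⟩)]

/-- **Survivor, case A** (`ar(B̃_S,P̃*) ≤ 0`, polynomial form `hgA`: the south end is `Z = Z̃_S = R_Y(W₁)`,
`Y = (6,−1,−5)`).  A contact of depth `> T₀` avoiding the caps of `W₁, W₂, B₁` satisfies
`ar(B₂,U) ≤ 0 ≤ ar(Z̃_S,U)`. -/
theorem survivorA {a b c x y z : ℝ} (hn : a ^ 2 + b ^ 2 + c ^ 2 = 2) (hu : x ^ 2 + y ^ 2 + z ^ 2 = 2)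
    (hg1 : 0 ≤ -b + a) (hg2 : 0 ≤ b + a) (hg3 : 0 ≤ -209 + 256 * c + 256 * b - 256 * a)
    (hg4 : 0 ≤ 2 - c ^ 2 - 2 * b * c - b ^ 2) (hg5 : 0 ≤ 5 - 8 * a) (hg6 : 0 ≤ -9 + 8 * c) (hg7 : 0 ≤ 5 - 16 * b)
    (hII : (b + c) ^ 2 < 2) (hgA : 0 ≤ -c ^ 3 + 3 * b * c ^ 2 + 6 * b ^ 2 * c - 8 * b ^ 3 + a * c ^ 2 - 8 * a * b * c - 2 * a * b ^ 2 + 5 * a ^ 2 * c - 11 * a ^ 2 * b + 3 * a ^ 3)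
    (hdT : b + c < a * x + b * y + c * z) (hUW1 : y + z ≤ 1) (hUW2 : -x + z ≤ 1) (hUB1 : x + y ≤ 1) :
    ((1) * ((y) * c - (z) * b) - (0) * ((x) * c - (z) * a) + (1) * ((x) * b - (y) * a)) ≤ 0 ∧ 0 ≤ ((-12 * c ^ 2 + 72 * b * c - 60 * b ^ 2 - 8 * a * c + 40 * a * b) * ((y) * c - (z) * b) - (-35 * c ^ 2 + 62 * b * c + 61 * b ^ 2 - 48 * a * c + 72 * a * b - 14 * a ^ 2) * ((x) * c - (z) * a) + (37 * c ^ 2 + 62 * b * c - 11 * b ^ 2 + 72 * a * c + 48 * a * b + 34 * a ^ 2) * ((x) * b - (y) * a)) := by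
  have kWZ := ar_W2_ZS_pos hn hg1 hg2 hg3 hg4 hg5 hg6 hgA
  have kBZ := ar_B1_ZS_neg hn hg1 hg2 hg3 hg4
  refine survivor_core hn hu hg1 hg2 hg3 hg4 hg5 hg6 hg7 hII hdT hUW1 hUW2 hUB1 kWZ kBZ ?_
  intro hZ hW2
  have kWB := ar_W2_BS_pos hn hg1 hg2 hg3 hg4 hg5 hg6
  have hBZ := ar_BS_ZS_neg hn hg1 hg2 hg3 hg4 hg5 hg6 hgA
  have hPZ := ar_Ps_ZS_neg hn hg1 hg2 hg3 hg4
  have hf4 := fact_f4 hn hg1 hg2 hg3 hg6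
  have hZW : ((-12 * c ^ 2 + 72 * b * c - 60 * b ^ 2 - 8 * a * c + 40 * a * b) * ((0) * c - (1) * b) - (-35 * c ^ 2 + 62 * b * c + 61 * b ^ 2 - 48 * a * c + 72 * a * b - 14 * a ^ 2) * (((-1)) * c - (1) * a) + (37 * c ^ 2 + 62 * b * c - 11 * b ^ 2 + 72 * a * c + 48 * a * b + 34 * a ^ 2) * (((-1)) * b - (0) * a)) < 0 := by linarith only [kWZ]
  -- `ar(B̃_S, U) < 0` (Plücker for `(Z̃_S, W₂, U, B̃_S)`)
  have pl3 := ar_plucker a b c (-12 * c ^ 2 + 72 * b * c - 60 * b ^ 2 - 8 * a * c + 40 * a * b) (-35 * c ^ 2 + 62 * b * c + 61 * b ^ 2 - 48 * a * c + 72 * a * b - 14 * a ^ 2) (37 * c ^ 2 + 62 * b * c - 11 * b ^ 2 + 72 * a * c + 48 * a * b + 34 * a ^ 2) (-1) 0 1 x y z (2 * b * c - 2 * b ^ 2 + 2 * a * b) (-c ^ 2 + 2 * b * c + 2 * b ^ 2 - 2 * a * c + 2 * a * b - a ^ 2) (c ^ 2 + 2 * b * c + 2 * a * c + 2 * a * b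 + a ^ 2)
  have hZB : ((2 * b * c - 2 * b ^ 2 + 2 * a * b) * (y * c - z * b) - (-c ^ 2 + 2 * b * c + 2 * b ^ 2 - 2 * a * c + 2 * a * b - a ^ 2) * (x * c - z * a) + (c ^ 2 + 2 * b * c + 2 * a * c + 2 * a * b + a ^ 2) * (x * b - y * a)) < 0 := by
    have e : ((2 * b * c - 2 * b ^ 2 + 2 * a * b) * (y * c - z * b) - (-c ^ 2 + 2 * b * c + 2 * b ^ 2 - 2 * a * c + 2 * a * b - a ^ 2) * (x * c - z * a) + (c ^ 2 + 2 * b * c + 2 * a * c + 2 * a * b + a ^ 2) * (x * b - y * a)) = -((x) * ((-c ^ 2 + 2 * b * c + 2 * b ^ 2 - 2 * a * c + 2 * a * b - a ^ 2) * c - (c ^ 2 + 2 * b * c + 2 * a * c + 2 * a * b + a ^ 2) * b) - (y) * ((2 * b * c - 2 * b ^ 2 + 2 * a * b) * c - (c ^ 2 + 2 * b * c + 2 * a * c + 2 * a * b + a ^ 2) * a) + (z) * ((2 * b * c - 2 * b ^ 2 + 2 * a * b) * b - (-c ^ 2 + 2 * b * c + 2 * b ^ 2 - 2 * a * c + 2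 * a * b - a ^ 2) * a)) := by ring
    have hR : ((-12 * c ^ 2 + 72 * b * c - 60 * b ^ 2 - 8 * a * c + 40 * a * b) * ((0) * c - (1) * b) - (-35 * c ^ 2 + 62 * b * c + 61 * b ^ 2 - 48 * a * c + 72 * a * b - 14 * a ^ 2) * (((-1)) * c - (1) * a) + (37 * c ^ 2 + 62 * b * c - 11 * b ^ 2 + 72 * a * c + 48 * a * b + 34 * a ^ 2) * (((-1)) * b - (0) * a)) * ((x) * ((-c ^ 2 + 2 * b * c + 2 * b ^ 2 - 2 * a * c + 2 * a * b - a ^ 2) * c - (c ^ 2 + 2 * b * c + 2 * a * c + 2 * a * b + a ^ 2) * b) - (y) * ((2 * b * c - 2 * b ^ 2 + 2 * a * b) * c - (c ^ 2 + 2 * b * c + 2 * a * c + 2 * a * b + a ^ 2) * a) + (z) * ((2 * b * c - 2 * b ^ 2 + 2 * a * b) * b - (-c ^ 2 + 2 * b * c + 2 * b ^ 2 - 2 * a * c + 2 * a * b - a ^ 2) * a)) < 0 := by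
      nlinarith only [pl3, mul_neg_of_neg_of_pos hZ kWB, mul_pos (by linarith only [hBZ] : (0:ℝ) < ((-12 * c ^ 2 + 72 * b * c - 60 * b ^ 2 - 8 * a * c + 40 * a * b) * ((-c ^ 2 + 2 * b * c + 2 * b ^ 2 - 2 * a * c + 2 * a * b - a ^ 2) * c - (c ^ 2 + 2 * b * c + 2 * a * c + 2 * a * b + a ^ 2) * b) - (-35 * c ^ 2 + 62 * b * c + 61 * b ^ 2 - 48 * a * c + 72 * a * b - 14 * a ^ 2) * ((2 * b * c - 2 * b ^ 2 + 2 * a * b) * c - (c ^ 2 + 2 * b * c + 2 * a * c + 2 * a * b + a ^ 2) * a) + (37 * c ^ 2 + 62 * b * c - 11 * b ^ 2 + 72 * a * c + 48 * a * b + 34 * a ^ 2) * ((2 * b * c - 2 * b ^ 2 + 2 * a * b) * b - (-c ^ 2 + 2 * b * c + 2 * b ^ 2 - 2 * a * c + 2 * a * b - a ^ 2) * a))) hW2]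
    rw [e]
    by_contra h
    push Not at h
    nlinarith only [hR, mul_nonneg_of_nonpos_of_nonpos hZW.le (by linarith only [h] : ((x) * ((-c ^ 2 + 2 * b * c + 2 * b ^ 2 - 2 * a * c + 2 * a * b - a ^ 2) * c - (c ^ 2 + 2 * b * c + 2 * a * c + 2 * a * b + a ^ 2) * b) - (y) * ((2 * b * c - 2 * b ^ 2 + 2 * a * b) * c - (c ^ 2 + 2 * b * c + 2 * a * c + 2 * a * b + a ^ 2) * a) + (z) * ((2 * b * c - 2 * b ^ 2 + 2 * a * b) * b - (-c ^ 2 + 2 * b * c + 2 * b ^ 2 - 2 * a * c + 2 * a * b - a ^ 2) * a)) ≤ 0)]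
  -- `ar(U, P̃*) > 0` (Plücker for `(Z̃_S, W₂, U, P̃*)`)
  have pl1 := ar_plucker a b c (-12 * c ^ 2 + 72 * b * c - 60 * b ^ 2 - 8 * a * c + 40 * a * b) (-35 * c ^ 2 + 62 * b * c + 61 * b ^ 2 - 48 * a * c + 72 * a * b - 14 * a ^ 2) (37 * c ^ 2 + 62 * b * c - 11 * b ^ 2 + 72 * a * c + 48 * a * b + 34 * a ^ 2) (-1) 0 1 x y z 1 (-1) 4
  have hP : 0 < ((x) * (((-1)) * c - (4) * b) - (y) * ((1) * c - (4) * a) + (z) * ((1) * b - ((-1)) * a)) := by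
    have hR : ((-12 * c ^ 2 + 72 * b * c - 60 * b ^ 2 - 8 * a * c + 40 * a * b) * ((0) * c - (1) * b) - (-35 * c ^ 2 + 62 * b * c + 61 * b ^ 2 - 48 * a * c + 72 * a * b - 14 * a ^ 2) * (((-1)) * c - (1) * a) + (37 * c ^ 2 + 62 * b * c - 11 * b ^ 2 + 72 * a * c + 48 * a * b + 34 * a ^ 2) * (((-1)) * b - (0) * a)) * ((x) * (((-1)) * c - (4) * b) - (y) * ((1) * c - (4) * a) + (z) * ((1) * b - ((-1)) * a)) < 0 := by
      nlinarith only [pl1, mul_neg_of_neg_of_pos hZ (by linarith only [hf4] : (0:ℝ) < (((-1)) * (((-1)) * c - (4) * b) - (0) * ((1) * c - (4) * a) + (1) * ((1) * b - ((-1)) * a))),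
        mul_pos (by linarith only [hPZ] : (0:ℝ) < ((-12 * c ^ 2 + 72 * b * c - 60 * b ^ 2 - 8 * a * c + 40 * a * b) * (((-1)) * c - (4) * b) - (-35 * c ^ 2 + 62 * b * c + 61 * b ^ 2 - 48 * a * c + 72 * a * b - 14 * a ^ 2) * ((1) * c - (4) * a) + (37 * c ^ 2 + 62 * b * c - 11 * b ^ 2 + 72 * a * c + 48 * a * b + 34 * a ^ 2) * ((1) * b - ((-1)) * a))) hW2]
    by_contra h
    push Not at h
    nlinarith only [hR, mul_nonneg_of_nonpos_of_nonpos hZW.le h]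
  exact south_exclusion hn hu hg1 hg2 hg3 hg4 hg5 hg6 hdT hUW1 hUW2 hZB hW2 hP

end Summit.Ventures.Crystal3D.Theorems
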